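import Mathlib

/-!
# Zero accretion, model form: the perturbed radial sink (stub `stub_radialSinkModel`)

Composing/mechanism stub `stub_radialSinkModel` of line `zero-accretion-selection` (crux `SkeletonEquilibrium`,
thesis `FilamentSkeletonRss`; lead a1). Near a stagnation point `t*` of a witness filament the sub-core
(`|k|e ≫ 1`) Kelvin content `h ∈ ℝ²` of the steady linearised equation obeys, with `s = t − t*`, `V = w′ s`,
`w′ s h′(s) = (Ω J + B) h(s) + (defect)`, where `Ω = 2g/e²` is the core's solid rotation and `B` the transverse
block of the velocity gradient, `tr B = 3/2 − w′` (divergence `3/2` of the frame drift; axial entry `w′` by the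
strain identity). Writing `(ΩJ + B)/w′ = a I + K`, `a = tr B/(2w′) = (3/2 − w′)/(2w′)`, `K = [[p, q], [r, −p]]`, the
regime `Ω → ∞` is `p² + qr < 0` and `|r|+|p|+q ≍ Ω`, `q − r ≍ 2Ω`, `−(p²+qr) ≍ Ω²`.

**Theorem (`radial_sink_blowup_perturbed`, = the registered `stub_radialSinkModel`).** With a RELATIVE defect
`|g₁| + |g₂| ≤ η(|h₁| + |h₂|)` and `a + 2η(|r|+|p|+q)(q−r)/(−(p²+qr)) < 0` (an allowance on `η` that is uniform in
`Ω`), every solution on `(0, s₀]` with `h(s₀) ≠ 0` is unbounded as `s → 0⁺`. Proof: the quadratic form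
`E = −r h₁² + 2p h₁h₂ + q h₂²` is positive definite (`(q−r)E ≥ −(p²+qr)(h₁²+h₂²)`), obeys `sE′ ≤ 2a′E` with
`a′ = a + 2η(…) < 0` (the `K`-part is skew for `E`), so `E·s^(−2a′)` is non-increasing on `(0, s₀]` and
`E(s) ≥ E(s₀)(s₀/s)^(2|a′|) → ∞`. Under (SC) `a < 0`: a witness that is merely bounded at its stagnation point
carries no sub-core content there, in either polarisation — zero accretion.
-/

noncomputable section

namespace Summit.NavierStokesRegularity.NavierStokesRegularity.Theorems.SkeletonEquilibrium.ZeroAccretionSelection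
set_option linter.dupNamespace false

/-- **Perturbed radial sink (the e-uniform interface).** Same system with a RELATIVE defect:
`|s h₁′ − ((a+p)h₁ + q h₂)| + |s h₂′ − (r h₁ + (a−p)h₂)| ≤ η (|h₁| + |h₂|)` on `(0, s₀]`, `q > 0`,
`D = −(p² + qr) > 0`. If `a + 2η (|r|+|p|+q)(q−r)/D < 0` then every solution with `h(s₀) ≠ 0` is
unbounded as `s → 0⁺`. (For `K = (ΩJ + B₀ − ½ tr B₀)/w′` one has `|r|+|p|+q ≍ Ω/w′`, `q − r ≍ 2Ω/w′`,
`D ≍ Ω²/w′²`, so the smallness condition on `η` is UNIFORM in the core rotation `Ω = 2g/e²`.) [folklore] -/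
theorem radial_sink_blowup_perturbed {a p q r η s₀ : ℝ} {h₁ h₂ : ℝ → ℝ}
    (hK : p ^ 2 + q * r < 0) (hq : 0 < q) (hη : 0 ≤ η)
    (ha : a + 2 * η * (|r| + |p| + q) * (q - r) / (-(p ^ 2 + q * r)) < 0) (hs₀ : 0 < s₀)
    (hsol : ∀ s, 0 < s → s ≤ s₀ → DifferentiableAt ℝ h₁ s ∧ DifferentiableAt ℝ h₂ s ∧
      |s * deriv h₁ s - (a * h₁ s + p * h₁ s + q * h₂ s)| +
        |s * deriv h₂ s - (a * h₂ s + r * h₁ s - p * h₂ s)| ≤ η * (|h₁ s| + |h₂ s|))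
    (h0 : h₁ s₀ ≠ 0 ∨ h₂ s₀ ≠ 0) :
    ∀ C : ℝ, ∃ s, 0 < s ∧ s ≤ s₀ ∧ C < h₁ s ^ 2 + h₂ s ^ 2 := by
  -- constants
  set D : ℝ := -(p ^ 2 + q * r) with hDdef
  have hD : 0 < D := by rw [hDdef]; linarith
  have hr : r < 0 := by
    by_contra hr'
    push Not at hr'
    have : 0 ≤ q * r := mul_nonneg hq.le hr'
    nlinarith [sq_nonneg p]
  have hqr : 0 < q - r := by linarith
  set M₁ : ℝ := |r| + |p| + q with hM₁def
  have hM₁ : 0 < M₁ := by rw [hM₁def]; positivity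
  set a' : ℝ := a + 2 * η * M₁ * (q - r) / D with ha'def
  have ha' : a' < 0 := ha
  -- the Lyapunov form, lower and upper bounds
  set E : ℝ → ℝ := fun σ => -r * h₁ σ ^ 2 + 2 * p * (h₁ σ * h₂ σ) + q * h₂ σ ^ 2 with hEdef
  have hEq : ∀ σ, q * E σ = (q * h₂ σ + p * h₁ σ) ^ 2 + D * h₁ σ ^ 2 := by
    intro σ; simp only [hEdef, hDdef]; ring
  have hEr : ∀ σ, (-r) * E σ = (r * h₁ σ - p * h₂ σ) ^ 2 + D * h₂ σ ^ 2 := by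
    intro σ; simp only [hEdef, hDdef]; ring
  have hElow : ∀ σ, D * (h₁ σ ^ 2 + h₂ σ ^ 2) ≤ (q - r) * E σ := by
    intro σ
    have h1 : D * h₁ σ ^ 2 ≤ q * E σ := by
      rw [hEq]; linarith [sq_nonneg (q * h₂ σ + p * h₁ σ)]
    have h2 : D * h₂ σ ^ 2 ≤ (-r) * E σ := by
      rw [hEr]; linarith [sq_nonneg (r * h₁ σ - p * h₂ σ)]
    have h3 : (q - r) * E σ = q * E σ + (-r) * E σ := by ring
    rw [h3]; linarith
  have hEle : ∀ σ, E σ ≤ M₁ * (h₁ σ ^ 2 + h₂ σ ^ 2) := by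
    intro σ
    simp only [hEdef, hM₁def]
    have h1 : -r * h₁ σ ^ 2 ≤ |r| * h₁ σ ^ 2 :=
      mul_le_mul_of_nonneg_right (le_trans (neg_le_abs r) le_rfl) (sq_nonneg _)
    have h2 : 2 * p * (h₁ σ * h₂ σ) ≤ |p| * (h₁ σ ^ 2 + h₂ σ ^ 2) := by
      have e1 : 2 * p * (h₁ σ * h₂ σ) ≤ |p| * (2 * |h₁ σ| * |h₂ σ|) := by
        calc 2 * p * (h₁ σ * h₂ σ) ≤ |2 * p * (h₁ σ * h₂ σ)| := le_abs_self _
          _ = |p| * (2 * |h₁ σ| * |h₂ σ|) := by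
              rw [abs_mul, abs_mul, abs_mul, abs_two]; ring
      have e2 : 2 * |h₁ σ| * |h₂ σ| ≤ |h₁ σ| ^ 2 + |h₂ σ| ^ 2 := two_mul_le_add_sq _ _
      rw [sq_abs, sq_abs] at e2
      exact le_trans e1 (mul_le_mul_of_nonneg_left e2 (abs_nonneg p))
    have h3 : 0 ≤ |r| * h₂ σ ^ 2 := by positivity
    have h4 : 0 ≤ q * h₁ σ ^ 2 := by positivity
    have h5 : (|r| + |p| + q) * (h₁ σ ^ 2 + h₂ σ ^ 2) =
        |r| * h₁ σ ^ 2 + |r| * h₂ σ ^ 2 + |p| * (h₁ σ ^ 2 + h₂ σ ^ 2) + q * h₁ σ ^ 2 + q * h₂ σ ^ 2 := by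
      ring
    rw [h5]; linarith
  have hEpos : 0 < E s₀ := by
    have h1 : 0 < h₁ s₀ ^ 2 + h₂ s₀ ^ 2 := by
      rcases h0 with h0 | h0
      · have := pow_pos (abs_pos.2 h0) 2; rw [sq_abs] at this; positivity
      · have := pow_pos (abs_pos.2 h0) 2; rw [sq_abs] at this; positivity
    have h2 : 0 < D * (h₁ s₀ ^ 2 + h₂ s₀ ^ 2) := mul_pos hD h1
    exact pos_of_mul_pos_right (lt_of_lt_of_le h2 (hElow s₀)) hqr.le
  -- the differential inequality s E′ ≤ 2 a′ E on (0, s₀]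
  have hEdiff : ∀ s, 0 < s → s ≤ s₀ → DifferentiableAt ℝ E s ∧ s * deriv E s ≤ 2 * a' * E s := by
    intro s hs hs'
    obtain ⟨hd₁, hd₂, hdef⟩ := hsol s hs hs'
    have hEd : DifferentiableAt ℝ E s := by simp only [hEdef]; fun_prop
    refine ⟨hEd, ?_⟩
    set g₁ : ℝ := s * deriv h₁ s - (a * h₁ s + p * h₁ s + q * h₂ s) with hg₁
    set g₂ : ℝ := s * deriv h₂ s - (a * h₂ s + r * h₁ s - p * h₂ s) with hg₂
    -- exact identity: s E′ = 2aE + 2[(−r h₁ + p h₂) g₁ + (p h₁ + q h₂) g₂]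
    have h1 := hd₁.hasDerivAt
    have h2 := hd₂.hasDerivAt
    have hsq1 : HasDerivAt (fun σ => h₁ σ ^ 2) (2 * h₁ s * deriv h₁ s) s := by
      convert h1.pow 2 using 1 <;> first | rfl | ring
    have hsq2 : HasDerivAt (fun σ => h₂ σ ^ 2) (2 * h₂ s * deriv h₂ s) s := by
      convert h2.pow 2 using 1 <;> first | rfl | ring
    have hE : HasDerivAt (fun σ => -r * h₁ σ ^ 2 + 2 * p * (h₁ σ * h₂ σ) + q * h₂ σ ^ 2)
        (-r * (2 * h₁ s * deriv h₁ s) + 2 * p * (deriv h₁ s * h₂ s + h₁ s * deriv h₂ s) +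
          q * (2 * h₂ s * deriv h₂ s)) s :=
      ((hsq1.const_mul (-r)).add ((h1.mul h2).const_mul (2 * p))).add (hsq2.const_mul q)
    have hident : s * deriv E s = 2 * a * E s +
        2 * ((-r * h₁ s + p * h₂ s) * g₁ + (p * h₁ s + q * h₂ s) * g₂) := by
      simp only [hEdef]
      rw [hE.deriv]
      have e1 : s * deriv h₁ s = a * h₁ s + p * h₁ s + q * h₂ s + g₁ := by rw [hg₁]; ring
      have e2 : s * deriv h₂ s = a * h₂ s + r * h₁ s - p * h₂ s + g₂ := by rw [hg₂]; ring
      have : s * (-r * (2 * h₁ s * deriv h₁ s) + 2 * p * (deriv h₁ s * h₂ s + h₁ s * deriv h₂ s) +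
          q * (2 * h₂ s * deriv h₂ s)) =
          -r * (2 * h₁ s * (s * deriv h₁ s)) + 2 * p * ((s * deriv h₁ s) * h₂ s + h₁ s * (s * deriv h₂ s)) +
          q * (2 * h₂ s * (s * deriv h₂ s)) := by ring
      rw [this, e1, e2]
      ring
    -- bound the defect term
    have hg : |g₁| + |g₂| ≤ η * (|h₁ s| + |h₂ s|) := hdef
    set S : ℝ := |h₁ s| + |h₂ s| with hSdef
    have hS : 0 ≤ S := by rw [hSdef]; positivity
    have hcoef1 : |-r * h₁ s + p * h₂ s| ≤ M₁ * S := by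
      have w1 : 0 ≤ |r| * |h₂ s| := by positivity
      have w2 : 0 ≤ |p| * |h₁ s| := by positivity
      have w3 : 0 ≤ q * (|h₁ s| + |h₂ s|) := by positivity
      calc |-r * h₁ s + p * h₂ s| ≤ |-r * h₁ s| + |p * h₂ s| := abs_add_le _ _
        _ = |r| * |h₁ s| + |p| * |h₂ s| := by rw [abs_mul, abs_mul, abs_neg]
        _ ≤ M₁ * S := by
            rw [hM₁def, hSdef]
            have : (|r| + |p| + q) * (|h₁ s| + |h₂ s|) = |r| * |h₁ s| + |p| * |h₂ s| +
                (|r| * |h₂ s| + |p| * |h₁ s| + q * (|h₁ s| + |h₂ s|)) := by ring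
            rw [this]; linarith
    have hcoef2 : |p * h₁ s + q * h₂ s| ≤ M₁ * S := by
      have w1 : 0 ≤ |r| * (|h₁ s| + |h₂ s|) := by positivity
      have w2 : 0 ≤ |p| * |h₂ s| := by positivity
      have w3 : 0 ≤ q * |h₁ s| := by positivity
      calc |p * h₁ s + q * h₂ s| ≤ |p * h₁ s| + |q * h₂ s| := abs_add_le _ _
        _ = |p| * |h₁ s| + q * |h₂ s| := by rw [abs_mul, abs_mul, abs_of_pos hq]
        _ ≤ M₁ * S := by
            rw [hM₁def, hSdef]
            have : (|r| + |p| + q) * (|h₁ s| + |h₂ s|) = |p| * |h₁ s| + q * |h₂ s| +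
                (|r| * (|h₁ s| + |h₂ s|) + |p| * |h₂ s| + q * |h₁ s|) := by ring
            rw [this]; linarith
    have hdefect : (-r * h₁ s + p * h₂ s) * g₁ + (p * h₁ s + q * h₂ s) * g₂ ≤ M₁ * S * (η * S) := by
      have t1 : (-r * h₁ s + p * h₂ s) * g₁ ≤ M₁ * S * |g₁| := by
        calc (-r * h₁ s + p * h₂ s) * g₁ ≤ |(-r * h₁ s + p * h₂ s) * g₁| := le_abs_self _
          _ = |-r * h₁ s + p * h₂ s| * |g₁| := abs_mul _ _
          _ ≤ M₁ * S * |g₁| := mul_le_mul_of_nonneg_right hcoef1 (abs_nonneg _)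
      have t2 : (p * h₁ s + q * h₂ s) * g₂ ≤ M₁ * S * |g₂| := by
        calc (p * h₁ s + q * h₂ s) * g₂ ≤ |(p * h₁ s + q * h₂ s) * g₂| := le_abs_self _
          _ = |p * h₁ s + q * h₂ s| * |g₂| := abs_mul _ _
          _ ≤ M₁ * S * |g₂| := mul_le_mul_of_nonneg_right hcoef2 (abs_nonneg _)
      have t3 : M₁ * S * (|g₁| + |g₂|) ≤ M₁ * S * (η * S) :=
        mul_le_mul_of_nonneg_left hg (by positivity)
      have t4 : M₁ * S * |g₁| + M₁ * S * |g₂| = M₁ * S * (|g₁| + |g₂|) := by ring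
      linarith
    have hsq : S * S ≤ 2 * (h₁ s ^ 2 + h₂ s ^ 2) := by
      have e := two_mul_le_add_sq (|h₁ s|) (|h₂ s|)
      rw [sq_abs, sq_abs] at e
      have : S * S = |h₁ s| ^ 2 + |h₂ s| ^ 2 + 2 * |h₁ s| * |h₂ s| := by rw [hSdef]; ring
      rw [this, sq_abs, sq_abs]; linarith
    have hnormE : h₁ s ^ 2 + h₂ s ^ 2 ≤ (q - r) / D * E s := by
      rw [div_mul_eq_mul_div, le_div_iff₀ hD]
      have := hElow s
      linarith [mul_comm D (h₁ s ^ 2 + h₂ s ^ 2)]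
    have hfin : (-r * h₁ s + p * h₂ s) * g₁ + (p * h₁ s + q * h₂ s) * g₂ ≤
        M₁ * η * (2 * ((q - r) / D * E s)) := by
      have u1 : M₁ * S * (η * S) = M₁ * η * (S * S) := by ring
      have u2 : M₁ * η * (S * S) ≤ M₁ * η * (2 * (h₁ s ^ 2 + h₂ s ^ 2)) :=
        mul_le_mul_of_nonneg_left hsq (by positivity)
      have u3 : M₁ * η * (2 * (h₁ s ^ 2 + h₂ s ^ 2)) ≤ M₁ * η * (2 * ((q - r) / D * E s)) :=
        mul_le_mul_of_nonneg_left (by linarith) (by positivity)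
      linarith [hdefect]
    have hring : 2 * a' * E s = 2 * a * E s + 2 * (M₁ * η * (2 * ((q - r) / D * E s))) := by
      rw [ha'def]; ring
    rw [hident, hring]
    linarith
  -- G = E · s^(−2a′) is antitone on (0, s₀]
  set G : ℝ → ℝ := fun σ => E σ * σ ^ (-2 * a') with hGdef
  have hGderiv : ∀ s, 0 < s → s ≤ s₀ →
      HasDerivAt G (deriv E s * s ^ (-2 * a') + E s * ((-2 * a') * s ^ (-2 * a' - 1))) s := by
    intro s hs hs'
    have hpow : HasDerivAt (fun σ : ℝ => σ ^ (-2 * a')) ((-2 * a') * s ^ (-2 * a' - 1)) s :=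
      Real.hasDerivAt_rpow_const (Or.inl hs.ne')
    exact (hEdiff s hs hs').1.hasDerivAt.mul hpow
  have hGderiv_nonpos : ∀ s, 0 < s → s ≤ s₀ → deriv G s ≤ 0 := by
    intro s hs hs'
    rw [(hGderiv s hs hs').deriv, Real.rpow_sub_one hs.ne']
    have hineq := (hEdiff s hs hs').2
    have hP : 0 < s ^ (-2 * a') := Real.rpow_pos_of_pos hs _
    have : deriv E s * s ^ (-2 * a') + E s * ((-2 * a') * (s ^ (-2 * a') / s)) =
        (s * deriv E s - 2 * a' * E s) * (s ^ (-2 * a') / s) := by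
      field_simp
      ring
    rw [this]
    exact mul_nonpos_of_nonpos_of_nonneg (by linarith) (div_nonneg hP.le hs.le)
  have hGanti : ∀ s, 0 < s → s ≤ s₀ → G s₀ ≤ G s := by
    intro s hs hs'
    have hcont : ContinuousOn G (Set.Icc s s₀) := by
      intro x hx
      exact (hGderiv x (lt_of_lt_of_le hs hx.1) hx.2).continuousAt.continuousWithinAt
    have hdiff : DifferentiableOn ℝ G (interior (Set.Icc s s₀)) := by
      rw [interior_Icc]
      intro x hx
      exact (hGderiv x (lt_trans hs hx.1) hx.2.le).differentiableAt.differentiableWithinAt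
    have hnonpos : ∀ x ∈ interior (Set.Icc s s₀), deriv G x ≤ 0 := by
      rw [interior_Icc]
      intro x hx
      exact hGderiv_nonpos x (lt_trans hs hx.1) hx.2.le
    exact antitoneOn_of_deriv_nonpos (convex_Icc s s₀) hcont hdiff hnonpos
      (Set.left_mem_Icc.2 hs') (Set.right_mem_Icc.2 hs') hs'
  -- conclusion: h₁² + h₂² ≥ E/M₁ = G s · s^(2a′)/M₁ ≥ G s₀ · s^(2a′)/M₁ → ∞
  intro C
  have hG₀ : 0 < G s₀ := by
    simp only [hGdef]
    exact mul_pos hEpos (Real.rpow_pos_of_pos hs₀ _)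
  have hc : 0 < G s₀ / M₁ := div_pos hG₀ hM₁
  obtain ⟨s, hs, hs', hbig⟩ : ∃ s, 0 < s ∧ s ≤ s₀ ∧ C < G s₀ / M₁ * s ^ (2 * a') := by
    have ht : Filter.Tendsto (fun s : ℝ => G s₀ / M₁ * s ^ (2 * a'))
        (nhdsWithin 0 (Set.Ioi 0)) Filter.atTop :=
      Filter.Tendsto.const_mul_atTop hc (tendsto_rpow_neg_nhdsGT_zero (by linarith : 2 * a' < 0))
    have h1 : ∀ᶠ s in nhdsWithin 0 (Set.Ioi 0), C < G s₀ / M₁ * s ^ (2 * a') :=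
      ht.eventually (Filter.eventually_gt_atTop _)
    have h2 : ∀ᶠ s in nhdsWithin 0 (Set.Ioi (0:ℝ)), s ≤ s₀ :=
      (eventually_le_nhds hs₀).filter_mono nhdsWithin_le_nhds
    have h3 : ∀ᶠ s in nhdsWithin 0 (Set.Ioi (0:ℝ)), 0 < s := eventually_mem_nhdsWithin
    obtain ⟨s, ⟨⟨h1s, h2s⟩, h3s⟩⟩ := ((h1.and h2).and h3).exists
    exact ⟨s, h3s, h2s, h1s⟩
  refine ⟨s, hs, hs', lt_of_lt_of_le hbig ?_⟩
  have hGs := hGanti s hs hs'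
  have hP : 0 < s ^ (2 * a') := Real.rpow_pos_of_pos hs _
  have h2 : s ^ (-2 * a') * s ^ (2 * a') = 1 := by
    rw [← Real.rpow_add hs]; norm_num
  have hEs : G s * s ^ (2 * a') = E s := by
    simp only [hGdef]
    calc E s * s ^ (-2 * a') * s ^ (2 * a') = E s * (s ^ (-2 * a') * s ^ (2 * a')) := by ring
      _ = E s := by rw [h2, mul_one]
  calc G s₀ / M₁ * s ^ (2 * a') ≤ G s / M₁ * s ^ (2 * a') := by gcongr
    _ = E s / M₁ := by rw [div_mul_eq_mul_div, hEs]
    _ ≤ h₁ s ^ 2 + h₂ s ^ 2 := by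
        rw [div_le_iff₀ hM₁]
        have := hEle s
        linarith [mul_comm M₁ (h₁ s ^ 2 + h₂ s ^ 2)]


/-- **Registered stub `stub_radialSinkModel`** (line `zero-accretion-selection`, STUB 1; signature verbatim):
the perturbed radial-sink blow-up, i.e. ZERO ACCRETION in model form. [folklore] -/
theorem stub_radialSinkModel :
    ∀ (a p q r η s₀ : ℝ) (h₁ h₂ : ℝ → ℝ), p ^ 2 + q * r < 0 → 0 < q → 0 ≤ η →
      a + 2 * η * (|r| + |p| + q) * (q - r) / (-(p ^ 2 + q * r)) < 0 → 0 < s₀ →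
      (∀ s, 0 < s → s ≤ s₀ → DifferentiableAt ℝ h₁ s ∧ DifferentiableAt ℝ h₂ s ∧
        |s * deriv h₁ s - (a * h₁ s + p * h₁ s + q * h₂ s)| +
          |s * deriv h₂ s - (a * h₂ s + r * h₁ s - p * h₂ s)| ≤ η * (|h₁ s| + |h₂ s|)) →
      (h₁ s₀ ≠ 0 ∨ h₂ s₀ ≠ 0) → ∀ C : ℝ, ∃ s, 0 < s ∧ s ≤ s₀ ∧ C < h₁ s ^ 2 + h₂ s ^ 2 :=
  fun _ _ _ _ _ _ _ _ hK hq hη ha hs₀ hsol h0 => radial_sink_blowup_perturbed hK hq hη ha hs₀ hsol h0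

end Summit.NavierStokesRegularity.NavierStokesRegularity.Theorems.SkeletonEquilibrium.ZeroAccretionSelection
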